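import Literature.MathematicalPhysics.QuantumFieldTheory.Balaban1983to89.B8CubeMemberBoxDomains

/-!
# `Balaban1983to89.B8CubeMemberBoxRows` — THE ROW DICTIONARY between the explicit flat Dirichlet multi-level matrix `K` of the cube member
# (`B8Prop6CubeMemberFlatScalar.prop6_cubeMember_flat_of_real`, [Balaban1985RegularSpaces] (1.91) p. 91 «Δ(1) + Q′*aQ′» on `{□_j}` of (1.131) p. 99)
# and p21's Neumann-box operator `B6MultiLevelBoxOperator.mlOp` ([Balaban1984PropagatorsII] (2.13)–(2.14) p. 225) at the member `B8CubeMemberBoxDomains.cubeDomains`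

statement-level skeleton of published theorems with citation tags; proofs where landed; nothing here is a claim about the
Yang–Mills mass gap

`[Balaban1985RegularSpaces]` ("B8", CMP **99** (1985) 75–102) (1.91) p. 91 («H′ = G′²Q′*(Q′G′²Q′*)⁻¹, G′ = (Δ + Q′*aQ′)⁻¹»), (1.131) p. 99, p. 98 («for every j
the cube □_j is a sum of the big blocks of the lattice T_{L^{−j}}»); `[Balaban1984PropagatorsII]` ("B6", CMP **96** (1984) 223–250) (2.13)–(2.14) p. 225
(«Δ′_a = Δ + Q′*aQ′ … ⟨λ, Q′*aQ′λ⟩ = Σ_j Σ_{y∈Λ_j} a_j(Lʲη)^{d−2}|(Q′_jλ)(y)|²»).  PDF held: `paper:balaban1985-cmp99-regular-spaces-gauge-fixing`.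

CITATION HEADER (lean-in-tree rule).  Cell `pub-ymgap` (YM Track A, HUMAN RULING D-0062), DAG node N05 = [B8], seat `pub-ymgap-dag-n05-c` (g9; (R1′)-v2 HYBRID
route for the REAL families of `prop6_cubeMember_flat_of_real`, file F2).  F1 = `B8CubeMemberBoxDomains` (p537372): the inner cube family `□₁ ⊃ … ⊃ □_n` as a
member `cubeDomains` of p21's Neumann-box family, with the tower-level dictionary `tower_iff_lev_eq` and r05's hypothesis-free (1.101) read at it.  THIS FILE
identifies THE ROWS: at every site `x ∈ □₁` all of whose `2(d+1)` neighbours lie in `□₁`, the consumer's explicit matrix `K` (Dirichlet Laplacian `η⁻²(−Δ)` on `□₀`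
plus the block-averaging terms of the truncation-`n` towers, weights `w_j`) acts on any lattice function exactly as `η⁻²·mlOp` of p21 acts on its translate —
the identity behind the two-region parametrix of the successor file (`T·(h̃_A·G_A·h_A f) = h_A f + [T, h̃_A]G_A h_A f` uses it at every row where `h̃_A ≠ 0`).

WHAT THIS FILE PROVES (kernel-checked; theorems only; `L = ℓ + 1`, dimension `d + 1`, cube datum `(a, M, ρ, k)`, truncation `1 ≤ n ≤ k`, the side
conditions of F1: `M_hL ∣ ρ`, `M_hL ∣ M`, `R·M_hL ≤ ρ`).
* §1 `stencil_sum`, ★ `K_row_sum` — a row of the consumer's `K` (ANY `L, η`, restriction sets `Λs`, weights `w`, finite site set `S`) applied to a function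
  `g` at a site with `x, x ± e_μ ∈ S`: `Σ_{z∈S}K(x,z)g(z) = η⁻²Σ_μ(2g(x) − g(x+e_μ) − g(x−e_μ)) + Σ_j[Bʲ(x)∈Λs j]·w_jL^{−2(d+1)j}·Σ_{z∈S, Bʲ(z)=Bʲ(x)}g(z)`.
* §2 `sum_nbrs_real`, ★ `mlOp_row_sum` — a row of p21's `mlOp` (ANY member `D` of `Domains`) applied to a function at an interior site of the box:
  `Σ_{y∈X}Δ′_a(x̂,y)G(y) = Σ_μ(2G(x̂) − G(x̂+e_μ) − G(x̂−e_μ)) + levC_{lev x̂}·Σ_{y∈X, B(y)=B(x̂)}G(y)` (degree `2(d+1)` by `card_nbrs`; `mlOp_apply`).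
* §3 translation bookkeeping: `pow_dvd_shift` (`Lʲ ∣ t` for `j ≤ n`), `blk_add_of_dvd` ∕ `blk_add_eq_iff` (block labels translate), `blockMap_eq_blk`, `e_eq_single` (`rfl`).
* §4 ★★ `row_eq_mlOp_row` — THE ROW DICTIONARY: for `x` with `x, x ± e_μ ∈ □₁` and EVERY `g`,
  `Σ_{z∈□₀} K(x,z)·g(z) = η⁻²·Σ_{y∈X} mlOp(x + t, y)·g(y − t)` at the member `cubeDomains`, provided the weights satisfy `w_j·L^{−2(d+1)j} = η⁻²·levC d ℓ a_j`
  (`1 ≤ j ≤ n`; i.e. `w_j = η⁻²a_jL^{(d−1)j}` — the consumer's weights are free).  Mechanism: §1 = §2 term by term — the Laplacian stencils translate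
  (`add_shift_single`), the level sum of `K` collapses to the tower level `j(x) = lev(x + t)` (F1 `tower_iff_lev_eq`), and the block of `x` (inside
  `□_{j(x)} ⊂ □₁ ⊂ □₀`, `towerBlock_subset_cube` ∕ `mem_cube_of_le_tower`) is carried onto the block of `x + t` by `z ↦ z + t` (`L^{j(x)} ∣ t`).

HONEST SCOPE ∕ NOT CLAIMED.  Finite-sum identities only; no estimate.  The dictionary holds ONLY at sites of `□₁` with all neighbours in `□₁` (elsewhere the
consumer's matrix has the Dirichlet rows of `□₀` and the level-0 unit-block terms, p21's has level-1 blocks and the Neumann rows of `X`); the weight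
relation fixes `w_j` for `1 ≤ j ≤ n` and leaves `w₀` free.  Count-neutral; N05 NOT discharged; one finite `T⁴` programme at fixed `ε`, Bałaban as printed;
nothing continuum ∕ ℝ⁴ ∕ OS ∕ mass-gap ∕ Clay.  No `sorry`, no `def`, no `instance`, no `notation`.  Unit `pub-ymgap-dag-n05-c` (g9), 2026-08-27.

RELATED IN THE TREE, NOT DUPLICATED: `B8CubeMemberBoxDomains.*` (F1, USED BY NAME), `B6MultiLevelBoxOperator.mlOp_apply`, `B4BoxCov237.opBoxR_mulVec` (the
`mulVec` form of the box operator over `boxNbrs`∕`boxBlk`; here the site-indexed form needed for the translation), `B4Green242Bridge.sum_nbrs` (the `ℂ`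
version; `sum_nbrs_real` is its cast), `B8Eq191FlatDirichletCoercive.*` ∕ `…Conjugation.*` (quadratic-form identities for the same `K`; no row identity there).
-/
noncomputable section

namespace Literature.MathematicalPhysics.QuantumFieldTheory.Balaban1983to89.B8CubeMemberBoxRows

open B6MultiLevelBoxOperator (Domains N0 bigSide mlOp levC)
open B4Reflection242 (boxDom mem_boxDom blk nbrs mem_nbrs neumannLapK avgK card_nbrs)
open B7Prop1Local (InBox)
open B7Prop1Explicit (e)
open B8Eq131Cubes (gs cube bLo bHi)
open B8Eq131CubesAdmissible (cubeFam cubeFam_false_of_le)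
open B8CubeMemberZd (cubeLamS)
open B8Eq191FlatDirichletDepth (fm loC hiC mem_cube_iff_inBox)
open B8CubeMemberBoxDomains (shift boxP lev cubeDomains mem_boxDom_of_mem_cube lev_eq_of_tower tower_iff_lev_eq add_shift_sub_shift)
open Literature.MathematicalPhysics.QuantumLattice (blockMap)

variable {d : ℕ}

/-! ## §1 A row of the consumer's matrix `K` applied to a lattice function -/

/-- The Laplacian stencil summed against a function: `Σ_{z∈S}(2[z=x] − [z=x+e_μ] − [z=x−e_μ])g(z) = 2g(x) − g(x+e_μ) − g(x−e_μ)` (`x, x ± e_μ ∈ S`).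
[folklore] [cite: Balaban1985RegularSpaces, (1.91) p.91] -/
theorem stencil_sum (S : Finset (Fin (d + 1) → ℤ)) {x : Fin (d + 1) → ℤ} (hx : x ∈ S) (μ : Fin (d + 1)) (hp : x + e μ ∈ S) (hm : x - e μ ∈ S)
    (g : (Fin (d + 1) → ℤ) → ℝ) :
    ∑ z ∈ S, ((2 : ℝ) * (if z = x then (1 : ℝ) else 0) - (if z = x + e μ then (1 : ℝ) else 0) - (if z = x - e μ then (1 : ℝ) else 0)) * g z
      = 2 * g x - g (x + e μ) - g (x - e μ) := by
  classical
  have h : ∀ z ∈ S, ((2 : ℝ) * (if z = x then (1 : ℝ) else 0) - (if z = x + e μ then (1 : ℝ) else 0) - (if z = x - e μ then (1 : ℝ) else 0)) * g z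
      = (if z = x then 2 * g z else 0) - (if z = x + e μ then g z else 0) - (if z = x - e μ then g z else 0) := by
    intro z _
    split_ifs <;> ring
  rw [Finset.sum_congr rfl h, Finset.sum_sub_distrib, Finset.sum_sub_distrib, Finset.sum_ite_eq' S x, if_pos hx,
    Finset.sum_ite_eq' S (x + e μ), if_pos hp, Finset.sum_ite_eq' S (x - e μ), if_pos hm]

open Classical in
/-- **A ROW OF THE FLAT MULTI-LEVEL MATRIX APPLIED TO A FUNCTION**: for the matrix `K` of `prop6_cubeMember_flat_of_real` (any `L, η`, restriction sets
`Λs`, weights `w`) and a site `x` with `x, x ± e_μ ∈ S`: `Σ_{z∈S} K(x,z)g(z) = η⁻²Σ_μ(2g(x) − g(x+e_μ) − g(x−e_μ)) + Σ_j [Bʲ(x) ∈ Λs j]·w_j L^{−2(d+1)j}·Σ_{z∈S, Bʲ(z)=Bʲ(x)} g(z)`.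
[cite: Balaban1985RegularSpaces, (1.91) p.91 («Δ(·) + Q*aQ»); Balaban1984PropagatorsII, (2.13)–(2.14) p.225] -/
theorem K_row_sum {η : ℝ} (L m : ℕ) (Λs : ℕ → Set (Fin (d + 1) → ℤ)) (w : ℕ → ℝ)
    (K : (Fin (d + 1) → ℤ) → (Fin (d + 1) → ℤ) → ℝ)
    (hK : ∀ x z, K x z = ((η ^ 2)⁻¹ * ∑ μ : Fin (d + 1), ((2 : ℝ) * (if z = x then (1 : ℝ) else 0) - (if z = x + e μ then (1 : ℝ) else 0)
        - (if z = x - e μ then (1 : ℝ) else 0))) +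
        (∑ j ∈ Finset.range (m + 1), (if blockMap (L ^ j) x ∈ Λs j ∧ blockMap (L ^ j) z = blockMap (L ^ j) x then
          w j * ((((L : ℝ) ^ (d + 1))⁻¹) ^ j) ^ 2 else 0)))
    (S : Finset (Fin (d + 1) → ℤ)) {x : Fin (d + 1) → ℤ} (hx : x ∈ S) (hxe : ∀ μ, x + e μ ∈ S ∧ x - e μ ∈ S) (g : (Fin (d + 1) → ℤ) → ℝ) :
    ∑ z ∈ S, K x z * g z
      = (η ^ 2)⁻¹ * ∑ μ : Fin (d + 1), (2 * g x - g (x + e μ) - g (x - e μ))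
        + ∑ j ∈ Finset.range (m + 1), (if blockMap (L ^ j) x ∈ Λs j then
            w j * ((((L : ℝ) ^ (d + 1))⁻¹) ^ j) ^ 2 * ∑ z ∈ S.filter (fun z => blockMap (L ^ j) z = blockMap (L ^ j) x), g z else 0) := by
  have hsplit : ∀ z ∈ S, K x z * g z
      = (η ^ 2)⁻¹ * (∑ μ : Fin (d + 1), ((2 : ℝ) * (if z = x then (1 : ℝ) else 0) - (if z = x + e μ then (1 : ℝ) else 0)
          - (if z = x - e μ then (1 : ℝ) else 0)) * g z)
        + ∑ j ∈ Finset.range (m + 1), (if blockMap (L ^ j) x ∈ Λs j ∧ blockMap (L ^ j) z = blockMap (L ^ j) x then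
          w j * ((((L : ℝ) ^ (d + 1))⁻¹) ^ j) ^ 2 else 0) * g z := by
    intro z _
    rw [hK, add_mul, mul_assoc, Finset.sum_mul, Finset.sum_mul]
  rw [Finset.sum_congr rfl hsplit, Finset.sum_add_distrib]
  congr 1
  · -- the Laplacian part
    rw [← Finset.mul_sum, Finset.sum_comm]
    congr 1
    exact Finset.sum_congr rfl fun μ _ => stencil_sum S hx μ (hxe μ).1 (hxe μ).2 g
  · -- the averaging part
    rw [Finset.sum_comm]
    refine Finset.sum_congr rfl fun j _ => ?_
    by_cases hj : blockMap (L ^ j) x ∈ Λs j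
    · rw [if_pos hj, Finset.mul_sum, Finset.sum_filter]
      refine Finset.sum_congr rfl fun z _ => ?_
      by_cases hz : blockMap (L ^ j) z = blockMap (L ^ j) x
      · rw [if_pos ⟨hj, hz⟩, if_pos hz]
      · rw [if_neg (fun h => hz h.2), if_neg hz, zero_mul]
    · rw [if_neg hj]
      exact Finset.sum_eq_zero fun z _ => by rw [if_neg (fun h => hj h.1), zero_mul]

/-! ## §2 A row of p21's `mlOp` applied to a function on the box -/

/-- The real form of `B4Green242Bridge.sum_nbrs`: `Σ_{z ∼ x} φ(z) = Σ_μ φ(x + e_μ) + Σ_μ φ(x − e_μ)`. [folklore] [cite: Balaban1984PropagatorsII, (2.13) p.225] -/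
theorem sum_nbrs_real (φ : (Fin (d + 1) → ℤ) → ℝ) (x : Fin (d + 1) → ℤ) :
    ∑ z ∈ nbrs x, φ z = ∑ μ, φ (x + Pi.single μ 1) + ∑ μ, φ (x - Pi.single μ 1) := by
  have h := B4Green242Bridge.sum_nbrs (fun z => (φ z : ℂ)) x
  exact_mod_cast h

/-- **A ROW OF `mlOp` APPLIED TO A FUNCTION** at an interior site `x̂` of the box (all `2(d+1)` neighbours in the box):
`Σ_{y∈X} Δ′_a(x̂,y)G(y) = Σ_μ(2G(x̂) − G(x̂+e_μ) − G(x̂−e_μ)) + levC_{lev x̂}·Σ_{y∈X, B(y)=B(x̂)} G(y)`. [cite: Balaban1984PropagatorsII, (2.13)–(2.14) p.225] -/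
theorem mlOp_row_sum {ℓ Mh k R : ℕ} {P : Fin (d + 1) → ℕ} (D : Domains d ℓ Mh k P R) (aw : ℕ → ℝ)
    (xh : ↥(boxDom (N0 ℓ Mh k P))) (hnb : ∀ μ, xh.1 + Pi.single μ 1 ∈ boxDom (N0 ℓ Mh k P) ∧ xh.1 - Pi.single μ 1 ∈ boxDom (N0 ℓ Mh k P))
    (G : (Fin (d + 1) → ℤ) → ℝ) :
    ∑ y : ↥(boxDom (N0 ℓ Mh k P)), mlOp (N0 ℓ Mh k P) ℓ k D.lev aw xh y * G y.1
      = ∑ μ : Fin (d + 1), (2 * G xh.1 - G (xh.1 + Pi.single μ 1) - G (xh.1 - Pi.single μ 1))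
        + levC d ℓ aw (D.lev xh.1) * ∑ y ∈ (boxDom (N0 ℓ Mh k P)).filter
            (fun y => blk ((ℓ + 1) ^ D.lev xh.1) y = blk ((ℓ + 1) ^ D.lev xh.1) xh.1), G y := by
  classical
  simp_rw [B6MultiLevelBoxOperator.mlOp_apply D rfl aw, add_mul, Finset.sum_add_distrib]
  -- pass from the subtype to the finite set of sites
  rw [show (∑ y : ↥(boxDom (N0 ℓ Mh k P)), (neumannLapK (N0 ℓ Mh k P) xh.1 y.1 : ℝ) * G y.1)
      = ∑ y ∈ boxDom (N0 ℓ Mh k P), (neumannLapK (N0 ℓ Mh k P) xh.1 y : ℝ) * G y from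
      (Finset.sum_coe_sort (boxDom (N0 ℓ Mh k P)) (fun y => (neumannLapK (N0 ℓ Mh k P) xh.1 y : ℝ) * G y)),
    show (∑ y : ↥(boxDom (N0 ℓ Mh k P)), avgK (levC d ℓ aw (D.lev xh.1)) ((ℓ + 1) ^ D.lev xh.1) xh.1 y.1 * G y.1)
      = ∑ y ∈ boxDom (N0 ℓ Mh k P), avgK (levC d ℓ aw (D.lev xh.1)) ((ℓ + 1) ^ D.lev xh.1) xh.1 y * G y from
      (Finset.sum_coe_sort (boxDom (N0 ℓ Mh k P)) (fun y => avgK (levC d ℓ aw (D.lev xh.1)) ((ℓ + 1) ^ D.lev xh.1) xh.1 y * G y))]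
  congr 1
  · -- Laplacian: degree `2(d+1)` at an interior point, `−1` on the neighbours
    have hsub : nbrs xh.1 ⊆ boxDom (N0 ℓ Mh k P) := by
      intro z hz
      obtain ⟨μ, h | h⟩ := mem_nbrs.mp hz
      · rw [h]; exact (hnb μ).1
      · rw [h]; exact (hnb μ).2
    have hcard : ((nbrs xh.1).filter fun z => z ∈ boxDom (N0 ℓ Mh k P)).card = 2 * (d + 1) := by
      rw [Finset.filter_true_of_mem (fun z hz => hsub hz), card_nbrs]
    have hpt : ∀ y ∈ boxDom (N0 ℓ Mh k P), (neumannLapK (N0 ℓ Mh k P) xh.1 y : ℝ) * G y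
        = (if y = xh.1 then (2 * ((d : ℝ) + 1)) * G y else 0) - (if y ∈ nbrs xh.1 then G y else 0) := by
      intro y _
      unfold neumannLapK
      by_cases hy : y = xh.1
      · subst hy
        have hnot : xh.1 ∉ nbrs xh.1 := by
          intro h
          obtain ⟨μ, h | h⟩ := mem_nbrs.mp h <;>
          · have h2 := congrFun h μ
            simp at h2
            try linarith
        rw [if_pos rfl, if_pos rfl, if_neg hnot, hcard]; push_cast; ring
      · rw [if_neg hy, if_neg hy]
        by_cases hyn : y ∈ nbrs xh.1
        · rw [if_pos hyn, if_pos hyn]; ring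
        · rw [if_neg hyn, if_neg hyn]; ring
    rw [Finset.sum_congr rfl hpt, Finset.sum_sub_distrib, Finset.sum_ite_eq' _ xh.1, if_pos xh.2, ← Finset.sum_filter,
      Finset.filter_mem_eq_inter, Finset.inter_eq_right.mpr hsub, sum_nbrs_real]
    rw [Finset.sum_sub_distrib, Finset.sum_sub_distrib, Finset.sum_const, Finset.card_univ, Fintype.card_fin]
    simp only [nsmul_eq_mul]
    push_cast
    ring
  · -- averaging
    rw [Finset.mul_sum, Finset.sum_filter]
    refine Finset.sum_congr rfl fun y _ => ?_
    unfold avgK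
    split_ifs <;> ring

/-! ## §3 Translation: blocks, neighbours and the consumer's sites -/

/-- `Lʲ ∣ t` coordinatewise for `j ≤ n ≤ k` (every summand of the translation is a multiple of `Lⁿ`). [cite: Balaban1985RegularSpaces, p.98] -/
theorem pow_dvd_shift (ℓ Mh : ℕ) (a : Fin (d + 1) → ℤ) (ρ : ℕ) {k n j : ℕ} (hjn : j ≤ n) (hnk : n ≤ k) (i : Fin (d + 1)) :
    ((ℓ + 1 : ℕ) : ℤ) ^ j ∣ shift ℓ Mh a ρ k n i := by
  obtain ⟨e1, he1⟩ := Nat.exists_eq_add_of_le hjn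
  obtain ⟨e2, he2⟩ := Nat.exists_eq_add_of_le (hjn.trans hnk)
  unfold shift loC fm
  simp only [bLo]
  refine ⟨(Mh * (ℓ + 1 : ℕ) ^ (e1 + 1) * ρ : ℤ) - ((ℓ + 1 : ℕ) : ℤ) ^ e2 * a i + ((ℓ + 1 : ℕ) : ℤ) ^ e1 * (ρ * gs (ℓ + 1) (k - n) : ℕ), ?_⟩
  rw [he2, show n = j + e1 from he1]
  push_cast
  ring

/-- Translating by a multiple of the block size shifts block labels: `blk b (z + t) = blk b z + t∕b`. [folklore] [cite: Balaban1985RegularSpaces, p.79] -/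
theorem blk_add_of_dvd {b : ℕ} (hb : 1 ≤ b) {t : Fin (d + 1) → ℤ} (q : Fin (d + 1) → ℤ) (ht : ∀ i, t i = (b : ℤ) * q i)
    (z : Fin (d + 1) → ℤ) : blk b (z + t) = blk b z + q := by
  have hb0 : (b : ℤ) ≠ 0 := by exact_mod_cast (by omega : b ≠ 0)
  funext i
  simp only [blk, Pi.add_apply, ht i]
  rw [Int.add_mul_ediv_left _ _ hb0]

/-- Hence same-block relations are translation invariant: `blk b (z + t) = blk b (x + t) ⇔ blk b z = blk b x` (`b ∣ t`).
[folklore] [cite: Balaban1985RegularSpaces, p.79] -/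
theorem blk_add_eq_iff {b : ℕ} (hb : 1 ≤ b) {t : Fin (d + 1) → ℤ} (ht : ∀ i, (b : ℤ) ∣ t i) (z x : Fin (d + 1) → ℤ) :
    blk b (z + t) = blk b (x + t) ↔ blk b z = blk b x := by
  choose q hq using ht
  rw [blk_add_of_dvd hb q hq z, blk_add_of_dvd hb q hq x]
  exact ⟨fun h => add_right_cancel h, fun h => by rw [h]⟩

/-- `blockMap` IS `blk`. [folklore] [cite: Balaban1985RegularSpaces, p.79] -/
theorem blockMap_eq_blk (b : ℕ) (z : Fin (d + 1) → ℤ) : blockMap b z = blk b z := rfl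

/-- `e μ` IS `Pi.single μ 1`. [folklore] [cite: Balaban1985RegularSpaces, p.79] -/
theorem e_eq_single (μ : Fin (d + 1)) : (e μ : Fin (d + 1) → ℤ) = Pi.single μ 1 := rfl

/-! ## §4 THE ROW DICTIONARY at interior sites of `□₁` -/

open B8Eq191FlatDirichletCoercive (towerBlock_subset_cube)
open B8Eq191FlatLettersCubeMember (cubeFam_subset_zero)

/-- Neighbours translate: `(x + t) ± e_μ = (x ± e_μ) + t`. [folklore] [cite: Balaban1985RegularSpaces, p.79] -/
theorem add_shift_single (t x : Fin (d + 1) → ℤ) (μ : Fin (d + 1)) :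
    x + t + Pi.single μ 1 = (x + e μ) + t ∧ x + t - Pi.single μ 1 = (x - e μ) + t := by
  constructor <;> (rw [e_eq_single]; abel)

open Classical in
/-- **THE ROW DICTIONARY.**  Let `K` be the explicit flat multi-level matrix of `prop6_cubeMember_flat_of_real` at truncation `n` (`L = ℓ + 1`,
restriction sets `cubeLamS … n`, weights `w` with `w_j·L^{−2(d+1)j} = η⁻²·levC d ℓ a j` for `1 ≤ j ≤ n`, i.e. `w_j = η⁻²a_jL^{(d−1)j}`), `S = □₀`,
and let `x ∈ □₁` have all its neighbours in `□₁`.  Then for EVERY lattice function `g`: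
`Σ_{z∈□₀} K(x,z)·g(z) = η⁻²·Σ_{y∈X} Δ′_a(x + t, y)·g(y − t)`, `Δ′_a = mlOp` of p21 at the member `cubeDomains` (level function `lev`).
Mechanism: both rows are `η⁻²(−Δ)` on the `2(d+1)` neighbours plus ONE block-averaging term at the tower level `j(x) = lev(x + t)` (§4 of
`B8CubeMemberBoxDomains`), the block of `x` lies in `□_{j(x)} ⊂ □₁ ⊂ □₀` and translates onto the block of `x + t` (`Lʲ ∣ t`).
[cite: Balaban1985RegularSpaces, (1.91) p.91, (1.131) p.99, p.98; Balaban1984PropagatorsII, (2.13)–(2.14) p.225, (2.1)–(2.4) p.224] -/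
theorem row_eq_mlOp_row {ℓ Mh : ℕ} (hℓ : 1 ≤ ℓ) (hMh : 1 ≤ Mh) (a : Fin (d + 1) → ℤ) {M ρ k n R : ℕ} (hn : 1 ≤ n) (hnk : n ≤ k)
    (hρd : Mh * (ℓ + 1) ∣ ρ) (hMd : Mh * (ℓ + 1) ∣ M) (hρ0 : 0 < ρ) (hR : R * (Mh * (ℓ + 1)) ≤ ρ)
    {η : ℝ} (w aw : ℕ → ℝ)
    (hw : ∀ j, 1 ≤ j → j ≤ n → w j * (((((ℓ + 1 : ℕ) : ℝ) ^ (d + 1))⁻¹) ^ j) ^ 2 = (η ^ 2)⁻¹ * levC d ℓ aw j)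
    (K : (Fin (d + 1) → ℤ) → (Fin (d + 1) → ℤ) → ℝ)
    (hK : ∀ x z, K x z = ((η ^ 2)⁻¹ * ∑ μ : Fin (d + 1), ((2 : ℝ) * (if z = x then (1 : ℝ) else 0) - (if z = x + e μ then (1 : ℝ) else 0)
        - (if z = x - e μ then (1 : ℝ) else 0))) +
        (∑ j ∈ Finset.range (n + 1), (if blockMap ((ℓ + 1) ^ j) x ∈ cubeLamS (ℓ + 1) a M ρ k n j ∧
            blockMap ((ℓ + 1) ^ j) z = blockMap ((ℓ + 1) ^ j) x then
          w j * (((((ℓ + 1 : ℕ) : ℝ) ^ (d + 1))⁻¹) ^ j) ^ 2 else 0)))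
    (S : Finset (Fin (d + 1) → ℤ)) (hS : ∀ z, z ∈ S ↔ z ∈ cubeFam false (ℓ + 1) a M ρ k 0)
    {x : Fin (d + 1) → ℤ} (hx : x ∈ cube (ℓ + 1) a M ρ k 1) (hxe : ∀ μ, x + e μ ∈ cube (ℓ + 1) a M ρ k 1 ∧ x - e μ ∈ cube (ℓ + 1) a M ρ k 1)
    (g : (Fin (d + 1) → ℤ) → ℝ) :
    ∑ z ∈ S, K x z * g z
      = (η ^ 2)⁻¹ * ∑ y : ↥(boxDom (N0 ℓ Mh n (boxP ℓ M ρ k n))),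
          mlOp (N0 ℓ Mh n (boxP ℓ M ρ k n)) ℓ n (lev ℓ Mh a M ρ k n) aw
            ⟨x + shift ℓ Mh a ρ k n, mem_boxDom_of_mem_cube hℓ hMh a hn hnk hx⟩ y * g (y.1 - shift ℓ Mh a ρ k n) := by
  have hL : 1 ≤ ℓ + 1 := Nat.succ_pos ℓ
  have hρL : ℓ + 1 ≤ ρ := le_trans (Nat.le_mul_of_pos_left _ hMh) (Nat.le_of_dvd hρ0 hρd)
  set t := shift ℓ Mh a ρ k n with ht
  set D := cubeDomains hMh a hn hnk hρd hMd hρ0 hR with hD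
  set xh : ↥(boxDom (N0 ℓ Mh n (boxP ℓ M ρ k n))) := ⟨x + t, mem_boxDom_of_mem_cube hℓ hMh a hn hnk hx⟩ with hxh
  -- `x ∈ □₁ ⊂ □₀ = S`, and its neighbours
  have h10 : cube (ℓ + 1) a M ρ k 1 ⊆ cubeFam false (ℓ + 1) a M ρ k 0 := by
    intro z hz
    have h1 : z ∈ cubeFam false (ℓ + 1) a M ρ k 1 := by rw [cubeFam_false_of_le _ a M ρ (hn.trans hnk)]; exact hz
    exact B8CubeMemberZd.hΩ_cubeFam hL a M hρL k 0 h1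
  have hxS : x ∈ S := (hS x).mpr (h10 hx)
  have hxeS : ∀ μ, x + e μ ∈ S ∧ x - e μ ∈ S := fun μ => ⟨(hS _).mpr (h10 (hxe μ).1), (hS _).mpr (h10 (hxe μ).2)⟩
  -- the consumer's row
  rw [K_row_sum (ℓ + 1) n (cubeLamS (ℓ + 1) a M ρ k n) w K (by simpa using hK) S hxS hxeS g]
  -- p21's row at `xh`, read through the member
  have hnb : ∀ μ, xh.1 + Pi.single μ 1 ∈ boxDom (N0 ℓ Mh n (boxP ℓ M ρ k n)) ∧
      xh.1 - Pi.single μ 1 ∈ boxDom (N0 ℓ Mh n (boxP ℓ M ρ k n)) := by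
    intro μ
    obtain ⟨h1, h2⟩ := add_shift_single t x μ
    refine ⟨?_, ?_⟩
    · rw [hxh]; dsimp only; rw [h1]; exact mem_boxDom_of_mem_cube hℓ hMh a hn hnk (hxe μ).1
    · rw [hxh]; dsimp only; rw [h2]; exact mem_boxDom_of_mem_cube hℓ hMh a hn hnk (hxe μ).2
  have hrow := mlOp_row_sum D aw xh hnb (fun y => g (y - t))
  rw [show (lev ℓ Mh a M ρ k n) = D.lev from rfl, hrow]
  -- the Laplacian parts agree after translating back
  obtain hj := fun μ => add_shift_single t x μ
  have hlap : ∑ μ : Fin (d + 1), (2 * g (xh.1 - t) - g (xh.1 + Pi.single μ 1 - t) - g (xh.1 - Pi.single μ 1 - t))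
      = ∑ μ : Fin (d + 1), (2 * g x - g (x + e μ) - g (x - e μ)) := by
    refine Finset.sum_congr rfl fun μ _ => ?_
    rw [(hj μ).1, (hj μ).2]
    simp only [hxh, ht, add_shift_sub_shift]
  rw [hlap, mul_add]
  congr 1
  -- the averaging parts: the sum over levels collapses to the tower level `j₀ = lev (x + t)`
  set j₀ := D.lev xh.1 with hj₀
  have hj₀' : lev ℓ Mh a M ρ k n (x + t) = j₀ := rfl
  have hj₀n : j₀ ≤ n := B8CubeMemberBoxDomains.lev_le ℓ Mh a M ρ k hn _
  have hcollapse : ∀ j ∈ Finset.range (n + 1),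
      (if blockMap ((ℓ + 1) ^ j) x ∈ cubeLamS (ℓ + 1) a M ρ k n j then
        w j * (((((ℓ + 1 : ℕ) : ℝ) ^ (d + 1))⁻¹) ^ j) ^ 2 *
          ∑ z ∈ S.filter (fun z => blockMap ((ℓ + 1) ^ j) z = blockMap ((ℓ + 1) ^ j) x), g z else 0)
      = if j₀ = j then w j * (((((ℓ + 1 : ℕ) : ℝ) ^ (d + 1))⁻¹) ^ j) ^ 2 *
          ∑ z ∈ S.filter (fun z => blockMap ((ℓ + 1) ^ j) z = blockMap ((ℓ + 1) ^ j) x), g z else 0 := by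
    intro j hj
    have hjn : j ≤ n := Nat.lt_succ_iff.mp (Finset.mem_range.mp hj)
    have hiff := tower_iff_lev_eq a M hρL hn hnk hjn hx (Mh := Mh)
    rw [hj₀'] at hiff
    by_cases h : blockMap ((ℓ + 1) ^ j) x ∈ cubeLamS (ℓ + 1) a M ρ k n j
    · rw [if_pos h, if_pos (hiff.mp h)]
    · rw [if_neg h, if_neg (fun h' => h (hiff.mpr h'))]
  rw [Finset.sum_congr rfl hcollapse, Finset.sum_ite_eq, if_pos (Finset.mem_range.mpr (Nat.lt_succ_of_le hj₀n))]
  -- `x` is at tower level `j₀ ≥ 1`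
  have htower : blockMap ((ℓ + 1) ^ j₀) x ∈ cubeLamS (ℓ + 1) a M ρ k n j₀ :=
    (tower_iff_lev_eq a M hρL hn hnk hj₀n hx (Mh := Mh)).mpr hj₀'
  have hj₀1 : 1 ≤ j₀ := (lev_eq_of_tower a M hρL hn hnk hj₀n hx htower (Mh := Mh)).1
  -- the block sums agree under `z ↦ z + t` (`L^{j₀} ∣ t`)
  have hdvd : ∀ i, (((ℓ + 1) ^ j₀ : ℕ) : ℤ) ∣ t i := fun i => by
    have := B8CubeMemberBoxRows.pow_dvd_shift ℓ Mh a ρ hj₀n hnk i (d := d)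
    push_cast at this ⊢; exact this
  have hb : 1 ≤ (ℓ + 1) ^ j₀ := Nat.one_le_pow _ _ hL
  have hblocks : (∑ z ∈ S.filter (fun z => blockMap ((ℓ + 1) ^ j₀) z = blockMap ((ℓ + 1) ^ j₀) x), g z)
      = ∑ y ∈ (boxDom (N0 ℓ Mh n (boxP ℓ M ρ k n))).filter (fun y => blk ((ℓ + 1) ^ j₀) y = blk ((ℓ + 1) ^ j₀) xh.1),
          g (y - t) := by
    refine Finset.sum_nbij' (fun z => z + t) (fun y => y - t) ?_ ?_ ?_ ?_ ?_
    · intro z hz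
      rw [Finset.mem_filter] at hz ⊢
      obtain ⟨hzS, hzq⟩ := hz
      have hzq' : blk ((ℓ + 1) ^ j₀) z = blk ((ℓ + 1) ^ j₀) x := by rw [← blockMap_eq_blk, ← blockMap_eq_blk]; exact hzq
      have hz1 : z ∈ cube (ℓ + 1) a M ρ k 1 :=
        B8Eq191FlatDirichletDepth.mem_cube_of_le_tower hL a M hρL hnk hj₀n hj₀1 (by rw [hzq]; exact htower)
      exact ⟨mem_boxDom_of_mem_cube hℓ hMh a hn hnk hz1, (blk_add_eq_iff hb hdvd z x).mpr hzq'⟩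
    · intro y hy
      rw [Finset.mem_filter] at hy ⊢
      obtain ⟨hyb, hyq⟩ := hy
      have hq : blk ((ℓ + 1) ^ j₀) (y - t) = blk ((ℓ + 1) ^ j₀) x := by
        rw [← blk_add_eq_iff hb hdvd (y - t) x, sub_add_cancel]; exact hyq
      refine ⟨(hS _).mpr ?_, ?_⟩
      · exact towerBlock_subset_cube hL a M hρL hnk hj₀n htower (by rw [blockMap_eq_blk]; exact hq)
      · rw [blockMap_eq_blk, blockMap_eq_blk]; exact hq
    · intro z _; exact add_sub_cancel_right z t
    · intro y _; exact sub_add_cancel y t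
    · intro z _; rw [add_sub_cancel_right]
  rw [hblocks, ← mul_assoc, hw j₀ hj₀1 hj₀n, mul_assoc]

end Literature.MathematicalPhysics.QuantumFieldTheory.Balaban1983to89.B8CubeMemberBoxRows
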